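import Summits.BirchSwinnertonDyer.BirchSwinnertonDyer.Theorems.ErratumRoadFiveEulerHalfNotRamNoInertSetOfSAV
import Summits.BirchSwinnertonDyer.BirchSwinnertonDyer.Theorems.ErratumRoadFiveEulerHalfNotRamNoInertSetOfGalTrivialRoad
import Summits.BirchSwinnertonDyer.BirchSwinnertonDyer.Theorems.ErratumRoadFiveEulerHalfNotRamNoInertSetOfAuxNorm
import Summits.BirchSwinnertonDyer.BirchSwinnertonDyer.Theorems.ErratumRoadFiveAuxNormTateComponentFamily
import Summits.BirchSwinnertonDyer.BirchSwinnertonDyer.Theorems.ErratumRoadFiveAuxPrimeChebotarevKummerSupply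
import Summits.BirchSwinnertonDyer.BirchSwinnertonDyer.Theorems.ErratumRoadFiveAuxPrimeSplitPrimeKummerWitness
import Summits.BirchSwinnertonDyer.BirchSwinnertonDyer.Theorems.ErratumRoadFiveNonSurjCornerEulerHalfInertPAnchorOfTwinLowerD
import Summits.BirchSwinnertonDyer.BirchSwinnertonDyer.Theorems.ErratumRoadFiveNonSurjCornerTwinLowerSupplyCertificates
import Summits.BirchSwinnertonDyer.BirchSwinnertonDyer.Theorems.ClassRecordThreeCornerAtThreeTwinLowerSupplyDefs
import HarnessLib

/-!
# Crux 19715 `ErratumRoadFive.EulerHalfNotRamNoInertSetAtFive` — line `twin_lower_supply` (ideator bsd-idea-9 g12, lens = complete)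

**THE ∃-RECUT OF THE X11a INPUT OF CRUX 19715.** The line of record (`Lines/birth.lean` v16 ∕ the LEAD's p655937 + p657101:
`EulerHalfLowerX11aFive.eulerHalfNotRamNoInertSetAtFive_of_sixItems_of_lowerX11aFive`) proves the crux from SIX route items
and the binder `h₃ : ∀ Wd p, ClassX11a Wd p → 5 ≤ p → MissingLowerBoundAt Wd p` — the `p ≥ 5` restriction of crux 19064
`X11aLowerHalf`, an ∀-statement over ALL rank-0 X11a pairs whose deep part (`#Ш_an(Wd)` not a `p`-unit) is main-conjecture
grade (`Cruxes/X11aLowerHalf/Lines/birth.lean` r17 `stub_mazurMCAtDeepFive`). READING THE PROOFS: `h₃` is consumed at exactly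
two places, both at an AUXILIARY QUADRATIC TWIST `Wd = (E^{(d_K)})_min` CHOSEN by a non-vanishing theorem —
(S1b, `p` the only multiplicative prime) `…JetchevMaxHLAtPConsumer` §3, `K` := the odd Hoffstein–Luo field of
`exists_admissibleField_of_rootNumber_eq_neg_one`; (`p`-anchor) `…PAnchorResidual` §6d ∕ `…OfLowerX11aFive` §2, `K` := the
carrier-inert Friedberg–Hoffstein fields, through `fhTwinLowerSupplyAt_of_friedbergHoffstein_of_x11aLowerHalf`. So the crux needs the
lower half NOT at every X11a pair but at ONE twist per frame family: this file re-keys both roads on two ∃-SUPPLIES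

* `HLTwinLowerSupplyAt W p` (§0, NEW, the S1b frame): SOME odd Heegner field `K` (`d_K < −4`, `N` and `p` split, `L(E^{(d_K)},1) ≠ 0`)
  with a global minimal model `Wd` of the twist carrying the twin's `≥`-half `Typed.MissingLowerBoundAt Wd p`;
* `Theorems.FHTwinLowerSupplyAt W p` (tree, corner-p1 g17's def; the `p`-anchor frames),

and proves **crux 19715 BY NAME ⟸ the six route items + the two supplies** (§3, both SAV roads), with (§4) BOTH SUPPLIES ⟸
`PublishedInputsFive` ∧ the `p ≥ 5` X11a lower half (so the recut is MONOTONE: it never asks more than the line of record; the LEAD's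
p657101 theorem is re-derived through it, `…_of_sixItems_of_lowerX11aFive'`) and (§0) BOTH SUPPLIES ⟸ per-pair UNIT-TWIST CERTIFICATES
(`hlTwinLowerSupplyAt_of_unitTwist` here; `fhTwinLowerSupplyAt_of_unitTwistTable` in the tree): a twist with `#Ш_an(Wd)` a `p`-unit
discharges the pair's X11a input with NO main conjecture. This is the 19065 r20 recut (corner-p1 g18, `…HybridSupplyKeyed`: «19064 NOT in
the cone») transplanted to the surjective crux; on 19715 it is new (no `Lines/*` or tree file keys 19715 on a supply; cell STATUS to 18:29Z).

WHAT THE TWO STUBS SAY (class-wide, OPEN, research statements — the COMPLETE-lens gap «named by the authors»; rev 1.1 wording,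
V73 P1 paid: Ono–Skinner, arXiv:math/9611225 Cor. 2 (numbering of the arXiv version read, [corpus:paper:arxiv-math_9611225 p0064–p0066];
Cor. 3 there is the CM case; the Annals numbering may differ): «for all but finitely many primes ℓ there are infinitely many fundamental
D < 0 for which L(E_D,1) ≠ 0 and S(E_D) ≢ 0 (mod ℓ)»; the survey [BJKOSV] Cor. 5 (p. 7, verbatim): a rank-ONE Ш UPPER bound «for all
primes p outside a finite set which is effectively determinable (see [O-S2])» — the page prints NO description of that set; that `p ∣ N` is
EXCLUDED is printed in [BJKOSV] Thm. 4 [B, Th. 2] (p. 6: the half-integral-weight engine needs `p ∤ M`, `M` the level of the weight-3/2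
form, a multiple of `4N` in the application to the twists via Waldspurger) and in Burungale–Hida–Tian (arXiv:1712.02148, Thm. 1.5, p. 4:
`p ∤ 6N∏_{ℓ∣N}(ℓ²−1)c_ℓd_ℓ`, ρ surjective); the «∏c» part of the exclusion is «per [O-S2] Thm. 1's hypotheses» and is NOT verifiable from
our garbled DVI copy — said so. At an X11b pair `p ∥ N` and `p ∣ c_p`, so NO printed engine supplies the twist — exactly the excluded
primes): `stub_hlTwinLowerSupplyFive` (S1b locus) and `stub_fhTwinLowerSupplyFive` (`p`-anchor locus). Why they might
fail: at `p` split in `K` the twist keeps `c_p(E^{(d)}) = c_p(E)`, so `p ∣ ∏c(Wd)` and a unit `#Ш_an(Wd)` means `ord_p L(Wd,1)/Ω(Wd)` EQUALS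
`ord_p ∏c(Wd) − 2 ord_p #tors(Wd) ≥ 1` on the nose — a second-order non-vanishing mod `p` (the level-lowered form `g` of level `N/p` has
`ε(g) = +1`, so `L(g^{(d)},1) = 0` on the whole Heegner family and the first-order Waldspurger ∕ theta-lift engines see nothing); expected for a
density of `d` (Delaunay heuristics for `Ш` of twists) but unproved at any fixed such `p`. Per pair the supplies are DECIDABLE by exact
modular-symbol numerics (lane B's CERT tables compute exactly these bits).

HONEST STATUS. `lean check`: sorries ONLY in the two `stub_*`; `EulerHalfNotRamNoInertSetAtFive_of` concludes the crux BY NAME from the two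
stubs' statements + six route items (19066, 19524, 19716, 20191, 20442, 27981). NOT registered (W-79: the LEAD er5-p1 and `Lines/birth.lean`
v16 are of record); no item changes state; no summit statement is proved by this seat; BSD is proved for no curve.
[cite: OnoSkinner1998, Cor. 2 (arXiv numbering)] [cite: BruinierEtAl1999, Cor. 5] [cite: HoffsteinLuo1997, Theorem (§1)] [cite: FriedbergHoffstein1995, Thm. B]
[cite: Jetchev2008, Thm. 1.4, Cor. 1.5] [cite: PastenShimura2024, Prop. 6.13, Lemma 6.18] [cite: Miller2011LMS, Def. 1.1]
-/

set_option autoImplicit false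
set_option linter.dupNamespace false

noncomputable section

open scoped Classical

/-! ### §0 The S1b-frame supply `HLTwinLowerSupplyAt`, its certificate door, the two line stubs -/

namespace Summit.BirchSwinnertonDyer.BirchSwinnertonDyer.Cruxes.EulerHalfNotRamNoInertSetAtFive.TwinLowerSupply

open WeierstrassCurve NumberField IsDedekindDomain Rat.HeightOneSpectrum
  Literature.NumberTheory.EllipticCurves
  Literature.NumberTheory.EllipticCurves.ModularForms
  Literature.NumberTheory.EllipticCurves.Rank1Residual
  Literature.NumberTheory.EllipticCurves.Rank1Residual.Typed
  Summit.BirchSwinnertonDyer.Rank1Residual Summit.BirchSwinnertonDyer.Rank1Residual.X11b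
  Summit.BirchSwinnertonDyer.Rank1Residual.X11b.Three.Koly
  Summit.BirchSwinnertonDyer.BirchSwinnertonDyer.Theorems
  Summit.BirchSwinnertonDyer.BirchSwinnertonDyer.Theorems.JetchevMaxHLAtP
  Summit.BirchSwinnertonDyer.BirchSwinnertonDyer.Theses.ErratumRoadFive

/-- OPEN (typed open input) — **`HLTwinLowerSupplyAt W p`: the TWIN-LOWER SUPPLY at an odd Hoffstein–Luo Heegner frame.** For `E = W/ℚ` and
the prime `p`: SOME imaginary quadratic `K` with `d_K` odd, `d_K < −4` (so `w_K = 2`, Mazur's Manin bound applies), every prime of `N_E` and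
`p` split in `K`, `L(E^{(d_K)},1) ≠ 0` — the FRAME, exactly the ∃-body of `exists_admissibleField_of_rootNumber_eq_neg_one` — TOGETHER WITH
a global minimal model `Wd = Cd • E^{(d_K)}` of the twist carrying the twin's `≥`-half `Typed.MissingLowerBoundAt Wd p`
(`ord_p #Ш_an(Wd) ≤ ord_p #Ш(Wd)`; FREE when `#Ш_an(Wd)` is a `p`-unit: `hlTwinLowerSupplyAt_of_unitTwist`). Exactly what the S1b
consumer `…JetchevMaxHLAtPConsumer` §3 uses of (Hoffstein–Luo ∧ crux 19064). A predicate on `(W, p)`; NEVER a theorem in this file.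
[cite: HoffsteinLuo1997, Theorem (§1) (the frame exists; shape only — nothing asserted)]
[cite: OnoSkinner1998, Cor. 2 (arXiv numbering; shape of a unit-twist supply «all but finitely many ℓ»; the excluded set is not described there — p ∣ N excluded per BJKOSV Thm. 4 `p ∤ M` / BHT Thm. 1.5; nothing asserted)]
[cite: Miller2011LMS, Def. 1.1 (shape of #Ш_an)] -/
@[conjecture]
def HLTwinLowerSupplyAt (W : WeierstrassCurve ℚ) [W.IsElliptic] (p : ℕ) : Prop :=
  ∃ (K : Type) (_ : Field K) (_ : NumberField K)
    (Wd : WeierstrassCurve ℚ) (_ : Wd.IsElliptic) (_ : Wd.IsGloballyMinimal) (Cd : VariableChange ℚ),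
    IsImaginaryQuadratic K ∧ Odd (NumberField.discr K) ∧ NumberField.discr K < -4 ∧
    SatisfiesHeegnerHypothesis (W.conductorNorm ℤ) K ∧ SatisfiesHeegnerHypothesis p K ∧
    (W.quadraticTwist (NumberField.discr K : ℚ)).entireLFunction 1 ≠ 0 ∧
    Cd • W.quadraticTwist (NumberField.discr K : ℚ) = Wd ∧ Typed.MissingLowerBoundAt Wd p

/-- **Certificate door (S1b frame): ONE odd Heegner frame with a UNIT `#Ш_an` twist gives `HLTwinLowerSupplyAt W p`.** DATA binders (the
splitting of the primes of `pN` in `K`, `L(E^{(d_K)},1) ≠ 0`, the minimal model `Wd`, and `X11a.ShaAnUnit Wd p` = «`#Ш_an(Wd) ∈ ℚ` is a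
`p`-unit», all decidable by exact numerics); the lower half at `Wd` is then `maxTwinLowerHalf_of_shaAnUnit`. Bookkeeping; nothing asserted
about any curve. [cite: HoffsteinLuo1997, Theorem (§1) (frame shape)] [cite: Miller2011LMS, Def. 1.1] -/
theorem hlTwinLowerSupplyAt_of_unitTwist (W : WeierstrassCurve ℚ) [W.IsElliptic] (p : ℕ) [Fact p.Prime]
    (K : Type) [Field K] [NumberField K] (hK : IsImaginaryQuadratic K) (hodd : Odd (NumberField.discr K))
    (hlt : NumberField.discr K < -4) (hHN : SatisfiesHeegnerHypothesis (W.conductorNorm ℤ) K)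
    (hHp : SatisfiesHeegnerHypothesis p K) (hLt : (W.quadraticTwist (NumberField.discr K : ℚ)).entireLFunction 1 ≠ 0)
    (Wd : WeierstrassCurve ℚ) [Wd.IsElliptic] [Wd.IsGloballyMinimal] (Cd : VariableChange ℚ)
    (hWd : Cd • W.quadraticTwist (NumberField.discr K : ℚ) = Wd) (hunit : X11a.ShaAnUnit Wd p) :
    HLTwinLowerSupplyAt W p :=
  ⟨K, inferInstance, inferInstance, Wd, inferInstance, inferInstance, Cd, hK, hodd, hlt, hHN, hHp, hLt, hWd,
    maxTwinLowerHalf_of_shaAnUnit Wd p hunit⟩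

/-- **`HLTwinLowerSupplyAt W p` ⟸ Hoffstein–Luo ∧ the X11a lower half AT `p ≥ 5`**, on an X11b ∧ ¬(ram) pair with `p ≥ 5` — the X11a
placement the S1b consumer `…JetchevMaxHLAtPConsumer` §3 performs inline, ISOLATED: the Hoffstein–Luo field (root number `−1` from
`analyticRank = 1`), a global minimal model of the twist (Néron), which is a rank-`0` X11a pair at `p` (`X11b.classX11a_twist_of_not_ram`),
so the lower half applies. So the supply is WEAKER than the pair of inputs it replaces. Bookkeeping; CONDITIONAL on the binders.
[cite: HoffsteinLuo1997, Theorem (§1)] [cite: Miller2011LMS, Def. 1.1] -/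
theorem hlTwinLowerSupplyAt_of_hoffsteinLuo_of_lowerX11aFive
    (hmod : hasEntireLFunction_rat) (hnf : exists_isNewformOf) (hHL : HoffsteinLuo1997_exists_twist_L_one_ne_zero)
    (hX11a : ∀ (Wd : WeierstrassCurve ℚ) [Wd.IsElliptic] [Wd.IsGloballyMinimal] (p : ℕ) [Fact p.Prime],
      ClassX11a Wd p → 5 ≤ p → Typed.MissingLowerBoundAt Wd p)
    (W : WeierstrassCurve ℚ) [W.IsElliptic] [W.IsGloballyMinimal] (p : ℕ) [Fact p.Prime]
    (hX : ClassX11b W p) (hp5 : 5 ≤ p) (hnram : ¬ Ram W p) :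
    HLTwinLowerSupplyAt W p := by
  obtain ⟨hr, -, -, -⟩ := id hX
  have hw : W.rootNumber = -1 := by
    rw [WeierstrassCurve.rootNumber_eq_neg_one_pow_analyticRank_of_exists_isNewformOf hnf W, hr]
    norm_num
  obtain ⟨K, _, _, hK, hodd, hlt, hHN, hHp, hLt⟩ :=
    exists_admissibleField_of_rootNumber_eq_neg_one hnf hHL W hw p
  have hD0 : (NumberField.discr K : ℚ) ≠ 0 := by exact_mod_cast NumberField.discr_ne_zero K
  haveI hEt : (W.quadraticTwist (NumberField.discr K : ℚ)).IsElliptic := W.isElliptic_quadraticTwist hD0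
  obtain ⟨Cd, hCd⟩ := hasGlobalMinimalModel_rat_holds (W.quadraticTwist (NumberField.discr K : ℚ))
  set Wd : WeierstrassCurve ℚ := Cd • W.quadraticTwist (NumberField.discr K : ℚ) with hWd_def
  haveI : Wd.IsGloballyMinimal := hCd
  have hWd : Cd • W.quadraticTwist (NumberField.discr K : ℚ) = Wd := rfl
  have hLt' : (W.quadraticTwist (NumberField.discr K : ℚ)).entireLFunction = Wd.entireLFunction := by
    rw [← hWd, entireLFunction_smul]
  have hLd1 : Wd.entireLFunction 1 ≠ 0 := by rw [← hLt']; exact hLt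
  have hrd0 : Wd.analyticRank = 0 := (Wd.analyticRank_eq_zero_iff_holds (hmod Wd)).2 hLd1
  have hXa : ClassX11a Wd p := X11b.classX11a_twist_of_not_ram W p hX hnram K hK hHN Cd hWd hrd0
  exact ⟨K, inferInstance, inferInstance, Wd, inferInstance, inferInstance, Cd, hK, hodd, hlt, hHN, hHp, hLt, hWd,
    hX11a Wd p hXa hp5⟩

/-- OPEN — **the S1b-locus supply statement of this line** (`p` the only multiplicative prime of an X11b ∧ surj ∧ ¬(ram) pair, `p ≥ 5`,
`p ∣ ∏c`): `HLTwinLowerSupplyAt W p`. A `Prop` constant; nothing asserted. [cite: OnoSkinner1998, Cor. 2 (arXiv numbering; shape only)] -/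
@[conjecture]
def HLTwinLowerSupplyFive : Prop :=
  ∀ (W : WeierstrassCurve ℚ) [W.IsElliptic] [W.IsGloballyMinimal] (p : ℕ) [Fact p.Prime],
    ClassX11b W p → 5 ≤ p → Surj W p → ¬ Ram W p → p ∣ W.tamagawaProduct →
    (∀ (ℓ : ℕ) [Fact ℓ.Prime], W.HasMultiplicativeReductionAtPrime ℓ → ℓ = p) →
    HLTwinLowerSupplyAt W p

/-- OPEN — **the `p`-anchor-locus supply statement of this line** (an X11b ∧ surj ∧ ¬(ram) pair, `p ≥ 5`, with a multiplicative prime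
`ℓ ≠ p`): `Theorems.FHTwinLowerSupplyAt W p` (corner-p1 g17's def, the currency of 19065 r20 slot 2″). A `Prop` constant; nothing asserted.
[cite: FriedbergHoffstein1995, Thm. B (shape only)] [cite: OnoSkinner1998, Cor. 2 (arXiv numbering; shape only)] -/
@[conjecture]
def FHTwinLowerSupplyFive : Prop :=
  ∀ (W : WeierstrassCurve ℚ) [W.IsElliptic] [W.IsGloballyMinimal] (p : ℕ) [Fact p.Prime],
    ClassX11b W p → 5 ≤ p → Surj W p → ¬ Ram W p →
    (∃ (ℓ : ℕ) (_ : Fact ℓ.Prime), ℓ ≠ p ∧ W.HasMultiplicativeReductionAtPrime ℓ) →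
    FHTwinLowerSupplyAt W p

/-- STUB (research statement, the hardest of the line) — the S1b-locus twin-lower supply `HLTwinLowerSupplyFive`. Why it might fail: at `p`
split in `K`, `p ∣ c_p(Wd) = c_p(E)`, so the lower half at `Wd` with unit `#Ш_an` is an EXACT second-order non-vanishing mod `p` in a thin
(Heegner, odd, `p`-split) family at a prime `p ∣ N`, `p ∣ c_p` that every printed engine excludes (`p ∤ M`: [BJKOSV] Thm. 4 p. 6; `p ∤ 6N∏(ℓ²−1)c_ℓd_ℓ`: BHT Thm. 1.5 p. 4). [cite: OnoSkinner1998, Cor. 2 (arXiv numbering)] [cite: BruinierEtAl1999, Thm. 4 (p. 6), Cor. 5 (p. 7)] -/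
theorem stub_hlTwinLowerSupplyFive : HLTwinLowerSupplyFive := by
  sorry

/-- STUB (research statement) — the `p`-anchor-locus twin-lower supply `FHTwinLowerSupplyFive` (one Friedberg–Hoffstein field per even set
of multiplicative primes, with the twin's `≥`-half at a minimal model of the twist). Why it might fail: as for the S1b stub, with `p` INERT in
`K` (then `c_p(Wd) ∈ {1, 2}` but the offending carriers `q ∈ T` keep `p ∣ c_q`), at the primes the printed engines exclude.
[cite: FriedbergHoffstein1995, Thm. B] [cite: OnoSkinner1998, Cor. 2 (arXiv numbering)] -/
theorem stub_fhTwinLowerSupplyFive : FHTwinLowerSupplyFive := by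
  sorry

end Summit.BirchSwinnertonDyer.BirchSwinnertonDyer.Cruxes.EulerHalfNotRamNoInertSetAtFive.TwinLowerSupply

/-! ### §1 S1b (`p` the only multiplicative prime) RE-KEYED on `HLTwinLowerSupplyAt` -/

namespace Summit.BirchSwinnertonDyer.BirchSwinnertonDyer.Cruxes.EulerHalfNotRamNoInertSetAtFive.TwinLowerSupply

open WeierstrassCurve NumberField IsDedekindDomain Rat.HeightOneSpectrum
  Literature.NumberTheory.EllipticCurves
  Literature.NumberTheory.EllipticCurves.ModularForms
  Literature.NumberTheory.EllipticCurves.Rank1Residual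
  Literature.NumberTheory.EllipticCurves.Rank1Residual.Typed
  Summit.BirchSwinnertonDyer.Rank1Residual Summit.BirchSwinnertonDyer.Rank1Residual.X11b
  Summit.BirchSwinnertonDyer.Rank1Residual.X11b.Three.Koly
  Summit.BirchSwinnertonDyer.BirchSwinnertonDyer.Theorems
  Summit.BirchSwinnertonDyer.BirchSwinnertonDyer.Theorems.JetchevMaxHLAtP
  Summit.BirchSwinnertonDyer.BirchSwinnertonDyer.Theses.ErratumRoadFive

/-- **The S1b consumer re-keyed: the Euler-system half on MONO-CARRIER surj X11b pairs at an odd `p` from `JetchevMaxHL`(p) and the SUPPLY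
`HLTwinLowerSupplyAt W p`** — the tree's `missingUpperBoundAt_of_classX11b_of_surj_of_not_ram_of_monoCarrier_of_jetchevMaxHL_of_lowerX11a`
(`…JetchevMaxHLAtPConsumer` §3) with its two binders `hHL` (Hoffstein–Luo) and `hX11a` (the X11a lower half at `p`) REPLACED by the one supply:
the frame `K` and the minimal twist model `Wd` with its lower half now COME FROM the supply instead of being derived; everything else verbatim
(Manin-good conductor-1 datum, bottom point `y_K`, `hJmax` to depth `ord_p ∏c` at the carrier, McCallum's sharpened bound, the twist
transports, x11b3's descent). The binder `¬ Ram W p` is no longer needed (it only placed the twist in class X11a). CONDITIONAL on every binder;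
nothing booked. [cite: Jetchev2008, Thm. 1.4, Cor. 1.5 (p. 812)] [cite: McCallumLMS1991, §5 Cor. 5.6 (p. 310)] [cite: Darmon2004, Thm. 3.6]
[cite: Miller2011LMS, Def. 1.1] -/
theorem missingUpperBoundAt_of_classX11b_of_surj_of_monoCarrier_of_jetchevMaxHL_of_hlTwinLowerSupply
    -- published named facts
    (hGZ : ∀ (N : ℕ) [NeZero N] (W : WeierstrassCurve ℚ) (K : Type) [Field K] [NumberField K],
      gross_zagier N W K)
    (hKo : ∀ (N : ℕ) [NeZero N] (W : WeierstrassCurve ℚ) (K : Type) [Field K] [NumberField K],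
      kolyvagin N W K)
    (hGZK : rank_eq_analyticRank_of_analyticRank_le_one) (hmod : hasEntireLFunction_rat)
    (hnf : exists_isNewformOf)
    (hMaz : mazur_not_dvd_maninConstant_of_odd)
    (hrec : ∀ (N : ℕ) [NeZero N] (W : WeierstrassCurve ℚ) (K : Type) [Field K] [NumberField K],
      heegnerPointOfConductor_one_galoisConj N W K)
    (hD36 : ∀ (N : ℕ) [NeZero N] (W : WeierstrassCurve ℚ) (K : Type) [Field K] [NumberField K],
      phi_heegnerTau_mem_singularModuliField N W K)
    (hMcU : McCallum1991_padicValNat_card_sha_primary_add_le_of_globalDivisibility)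
    (p : ℕ) [Fact p.Prime] (hp2 : p ≠ 2)
    -- OPEN INPUT `JetchevMaxHL`(p) (verbatim the consumer's binder)
    (hJmax : ∀ (W : WeierstrassCurve ℚ) [W.IsElliptic] [W.IsGloballyMinimal] [NeZero (W.conductorNorm ℤ)]
      (K : Type) [Field K] [NumberField K]
      (Dt : ModularParametrizationData W (W.conductorNorm ℤ)) (β : ℤ) (ι : K →+* ℂ),
      W.analyticRank = 1 → W.HasMultiplicativeReductionAtPrime p → Surj W p →
      IsImaginaryQuadratic K → SatisfiesHeegnerHypothesis (W.conductorNorm ℤ) K →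
      Odd (NumberField.discr K) → NumberField.discr K < -4 →
      (W.quadraticTwist (NumberField.discr K : ℚ)).entireLFunction 1 ≠ 0 →
      (4 * (W.conductorNorm ℤ : ℤ)) ∣ β ^ 2 - NumberField.discr K → ¬ (p : ℤ) ∣ Dt.c →
      ∀ (v : HeightOneSpectrum (𝓞 ℚ)) (s : ℕ), s ≤ padicValNat p (W.tamagawaNumberAt v) →
        ∀ (n : ℕ) (d : KolyvaginHeegnerData Dt β ι n), Squarefree n →
          (∀ ℓ ∈ n.primeFactors, Zhang2014.IsKolyvaginPrime (W.conductorNorm ℤ) W K p ℓ ∧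
            s ≤ Zhang2014.kolyvaginIndex W p ℓ) → PDiv d p s)
    -- the pair
    (W : WeierstrassCurve ℚ) [W.IsElliptic] [W.IsGloballyMinimal]
    (hX : ClassX11b W p) (hρ : Surj W p)
    (hmono : ∃ v : HeightOneSpectrum (𝓞 ℚ),
      padicValNat p W.tamagawaProduct ≤ padicValNat p (W.tamagawaNumberAt v))
    -- the SUPPLY at the pair (replaces `hHL` and `hX11a`)
    (hsup : HLTwinLowerSupplyAt W p) :
    Typed.MissingUpperBoundAt W p := by
  have hp : p.Prime := Fact.out
  haveI : NeZero (W.conductorNorm ℤ) := ⟨(W.conductorNorm_pos_holds).ne'⟩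
  obtain ⟨hr, -, hmult, hirr⟩ := id hX
  obtain ⟨v, hv⟩ := hmono
  -- the odd Heegner frame AND the minimal twist model with its lower half, from the supply
  obtain ⟨K, _, _, Wd, _, _, Cd, hK, hodd, hlt, hHN, hHp, hLt, hWd, hlow⟩ := hsup
  have hpd : ¬ (p : ℤ) ∣ NumberField.discr K := not_dvd_discr_of_split hK hp hp2 hHp
  have hμ : ¬ p ∣ Units.torsionOrder K := by
    haveI : IsTotallyComplex K := hK.2
    rw [Literature.NumberTheory.DiophantineGeometry.torsionOrder_eq_two_of_discr_lt hK.1 hlt]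
    intro h2
    have := Nat.le_of_dvd two_pos h2
    have := hp.two_le
    omega
  obtain ⟨Dt, H, ι, P, hP, hc⟩ :=
    exists_maninDatum_of_odd hnf hMaz integral_neronScaling_of_isGloballyMinimal_holds W p (W.conductorNorm ℤ)
      K rfl hp2 hmult hirr hK hHN
  have h3 : NumberField.discr K ≠ -3 := by omega
  have h4 : NumberField.discr K ≠ -4 := by omega
  -- a conductor-1 Kolyvagin–Heegner datum on the frame (Dt, H.β, ι), with bottom point y_K = P
  obtain ⟨d₁⟩ := exists_kolyvaginHeegnerData_one (hD36 _ W K) hK Dt H.β ι H.dvd_sq_sub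
  have hPd : d₁.toGeomPoints d₁.derivedPoint = toGeomPoints (W.baseChange K) P :=
    KolyvaginBottom.toGeomPoints_derivedPoint_one_eq (hrec _ W K) hK hHN hP d₁ rfl
  -- global divisibility to depth ord_p ∏c on this frame: the max binder at the carrier v
  have hJW : ∀ (s : ℕ), s ≤ padicValNat p W.tamagawaProduct →
      ∀ (n : ℕ) (d : KolyvaginHeegnerData Dt H.β ι n), Squarefree n →
        (∀ ℓ ∈ n.primeFactors, Zhang2014.IsKolyvaginPrime (W.conductorNorm ℤ) W K p ℓ ∧
          s ≤ Zhang2014.kolyvaginIndex W p ℓ) → PDiv d p s :=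
    fun s hs n d hn hℓ ↦ hJmax W K Dt H.β ι hr hmult hρ hK hHN hodd hlt hLt H.dvd_sq_sub hc v s
      (hs.trans hv) n d hn hℓ
  -- the sharpened bound over K at this datum, from the divisibility + McCallum (consumer §1)
  have hU : Finite (W.baseChange K).sha → ¬ IsOfFinAddOrder P →
      padicValNat p (Nat.card (W.baseChange K).sha) + 2 * padicValNat p W.tamagawaProduct ≤
        2 * padicValNat p (AddSubgroup.zmultiples P).index := by
    intro hfin hPinf
    haveI : Finite (W.baseChange K).sha := hfin
    obtain ⟨hrank, -⟩ := hKo (W.conductorNorm ℤ) W K hK hHN ⟨Dt, H, ι, hP⟩ hPinf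
    have hbot := torsionBy_eq_bot_of_isImaginaryQuadratic_of_hasIrreducibleModPGaloisRep W K hK hp hirr
    have hiv : ∀ x : (W.baseChange K).toAffine.Point, p • x = 0 → x = 0 := fun x hx ↦ by
      have hmem : x ∈ AddSubgroup.torsionBy (W.baseChange K).toAffine.Point ((p : ℕ) : ℤ) := by
        rw [mem_torsionBy_iff, natCast_zsmul]
        exact hx
      rw [hbot] at hmem
      exact hmem
    exact shaIndexBound_sharp_of_globalDivisibility hMcU W p hp2 K hmult hρ hK h3 h4 hHN Dt H.β ι d₁ P
      hPd hPinf hrank hiv hJW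
  -- the twist: transports, and the SUPPLIED lower half at its minimal model, in print shape
  have hD0 : (NumberField.discr K : ℚ) ≠ 0 := by exact_mod_cast NumberField.discr_ne_zero K
  haveI hEt : (W.quadraticTwist (NumberField.discr K : ℚ)).IsElliptic :=
    W.isElliptic_quadraticTwist hD0
  have hirrd : Wd.HasIrreducibleModPGaloisRep p :=
    hasIrreducibleModPGaloisRep_twist_model W p K hK.1 hirr Cd hWd
  have htam : padicValNat p Wd.tamagawaProduct = padicValNat p W.tamagawaProduct :=
    X2.padicValNat_tamagawaProduct_twist_of_heegner_of_odd W p hp2 K hK hodd hpd hHN Cd hWd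
  have hu : padicValRat p (Cd.u : ℚ) = 0 :=
    padicValRat_u_eq_zero_of_twist_minimal W p K hK hHN hmult Cd hWd
  have hLt' : (W.quadraticTwist (NumberField.discr K : ℚ)).entireLFunction = Wd.entireLFunction := by
    rw [← hWd, entireLFunction_smul]
  have hLd1 : Wd.entireLFunction 1 ≠ 0 := by rw [← hLt']; exact hLt
  have hrd0 : Wd.analyticRank = 0 := (Wd.analyticRank_eq_zero_iff_holds (hmod Wd)).2 hLd1
  obtain ⟨qd, hqd, hvqd⟩ :=
    AdditivePotMult.exists_printShape_lower_of_missingLowerBoundAt_rankZero Wd hGZK hrd0 hirrd hlow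
  -- descent to ℚ (x11b3's data-level arithmetic)
  exact missingUpperBoundAt_of_shaIndexBound_sharp W p (W.conductorNorm ℤ) K Dt H ι P (hGZ _ W K)
    (hKo _ W K) hGZK hmod hK hHN hP hp2 hc hμ hr hLt Wd Cd hWd hu htam le_rfl ⟨qd, hqd, hvqd⟩ hU

/-- Place ↔ prime bridge for SPLIT multiplicative reduction (copy of the private bridge of `…JetchevMaxHLAtPConsumer` §4 ∕ `…OfLowerX11aFive` §1).
[folklore] -/
private theorem hasSplitMultiplicativeReductionAt_of_atPrime' (W : WeierstrassCurve ℚ) [W.IsElliptic]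
    (v : HeightOneSpectrum (𝓞 ℚ)) (p : ℕ) [Fact p.Prime] (hv : (primesEquiv v : ℕ) = p)
    (h : W.HasSplitMultiplicativeReductionAtPrime p) : W.HasSplitMultiplicativeReductionAt v := by
  subst hv
  exact (hasSplitMultiplicativeReductionAtPrime_iff_hasSplitMultiplicativeReductionAt W v).mp h

/-- **S1b of crux 19715 (registered text of the former `stub_res_pOnlyMultCarrierAtFive`, binders VERBATIM as conclusion) from `JetchevMaxHL`(p)
and the SUPPLY statement `HLTwinLowerSupplyFive`** — the tree's `res_pOnlyMultCarrierAtFive_of_jetchevMaxHL_of_lowerX11aFive` with (Hoffstein–Luo ∧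
the `p ≥ 5` X11a lower half) replaced by the supply; body verbatim (the place of `p` is the unique split multiplicative place, so it carries all
of `ord_p ∏c`: `CornerLocal.padicValNat_tamagawaNumberAt_eq_of_unique_split`). CONDITIONAL; nothing booked.
[cite: Jetchev2008, Thm. 1.4 (p. 812)] [cite: SilvermanATAEC1994, Cor. IV.9.2 (d)] [cite: Miller2011LMS, Def. 1.1] -/
theorem res_pOnlyMultCarrierAtFive_of_jetchevMaxHL_of_hlTwinLowerSupply
    (hGZ : ∀ (N : ℕ) [NeZero N] (W : WeierstrassCurve ℚ) (K : Type) [Field K] [NumberField K],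
      gross_zagier N W K)
    (hKo : ∀ (N : ℕ) [NeZero N] (W : WeierstrassCurve ℚ) (K : Type) [Field K] [NumberField K],
      kolyvagin N W K)
    (hGZK : rank_eq_analyticRank_of_analyticRank_le_one) (hmod : hasEntireLFunction_rat)
    (hnf : exists_isNewformOf)
    (hMaz : mazur_not_dvd_maninConstant_of_odd)
    (hrec : ∀ (N : ℕ) [NeZero N] (W : WeierstrassCurve ℚ) (K : Type) [Field K] [NumberField K],
      heegnerPointOfConductor_one_galoisConj N W K)
    (hD36 : ∀ (N : ℕ) [NeZero N] (W : WeierstrassCurve ℚ) (K : Type) [Field K] [NumberField K],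
      phi_heegnerTau_mem_singularModuliField N W K)
    (hMcU : McCallum1991_padicValNat_card_sha_primary_add_le_of_globalDivisibility)
    (hJmax : ∀ (W : WeierstrassCurve ℚ) [W.IsElliptic] [W.IsGloballyMinimal] (p : ℕ) [Fact p.Prime]
      [NeZero (W.conductorNorm ℤ)] (K : Type) [Field K] [NumberField K]
      (Dt : ModularParametrizationData W (W.conductorNorm ℤ)) (β : ℤ) (ι : K →+* ℂ),
      5 ≤ p → W.analyticRank = 1 → W.HasMultiplicativeReductionAtPrime p → Surj W p →
      IsImaginaryQuadratic K → SatisfiesHeegnerHypothesis (W.conductorNorm ℤ) K →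
      Odd (NumberField.discr K) → NumberField.discr K < -4 →
      (W.quadraticTwist (NumberField.discr K : ℚ)).entireLFunction 1 ≠ 0 →
      (4 * (W.conductorNorm ℤ : ℤ)) ∣ β ^ 2 - NumberField.discr K → ¬ (p : ℤ) ∣ Dt.c →
      ∀ (v : HeightOneSpectrum (𝓞 ℚ)) (s : ℕ), s ≤ padicValNat p (W.tamagawaNumberAt v) →
        ∀ (n : ℕ) (d : KolyvaginHeegnerData Dt β ι n), Squarefree n →
          (∀ ℓ ∈ n.primeFactors, Zhang2014.IsKolyvaginPrime (W.conductorNorm ℤ) W K p ℓ ∧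
            s ≤ Zhang2014.kolyvaginIndex W p ℓ) → PDiv d p s)
    (hsup : HLTwinLowerSupplyFive) :
    ∀ (W : WeierstrassCurve ℚ) [W.IsElliptic] [W.IsGloballyMinimal] (p : ℕ) [Fact p.Prime],
      Summit.BirchSwinnertonDyer.Rank1Residual.ClassX11b W p → 5 ≤ p →
      Literature.NumberTheory.EllipticCurves.Rank1Residual.Surj W p →
      ¬ Literature.NumberTheory.EllipticCurves.Rank1Residual.Ram W p → p ∣ W.tamagawaProduct →
      (∀ (ℓ : ℕ) [Fact ℓ.Prime], W.HasMultiplicativeReductionAtPrime ℓ → ℓ = p) →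
      W.HasSplitMultiplicativeReductionAtPrime p → p ∣ padicValInt p W.minimalDiscriminantInt →
      Literature.NumberTheory.EllipticCurves.Rank1Residual.Typed.MissingUpperBoundAt W p := by
  intro W _ _ p _ hX hp5 hρ hnram htam honly hsplit _
  have hp : p.Prime := Fact.out
  have hp2 : p ≠ 2 := by omega
  -- the place of p is the UNIQUE split multiplicative place
  set v₀ : HeightOneSpectrum (𝓞 ℚ) := (primesEquiv (R := 𝓞 ℚ)).symm ⟨p, hp⟩ with hv₀_def
  have hv₀ : (primesEquiv v₀ : ℕ) = p := by rw [hv₀_def, Equiv.apply_symm_apply]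
  have hs₀ : W.HasSplitMultiplicativeReductionAt v₀ :=
    hasSplitMultiplicativeReductionAt_of_atPrime' W v₀ p hv₀ hsplit
  have huniq : ∀ v, W.HasSplitMultiplicativeReductionAt v → v = v₀ := by
    intro v hv
    haveI : Fact (primesEquiv v : ℕ).Prime := ⟨(primesEquiv v).2⟩
    have hmv : W.HasMultiplicativeReductionAtPrime (primesEquiv v : ℕ) :=
      (hasMultiplicativeReductionAtPrime_primesEquiv_iff_holds W v (primesEquiv v : ℕ) rfl).mpr
        hv.hasMultiplicativeReductionAt
    have hq : (primesEquiv v : ℕ) = p := honly _ hmv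
    apply (primesEquiv (R := 𝓞 ℚ)).injective
    rw [hv₀_def, Equiv.apply_symm_apply]
    exact Subtype.ext hq
  have hmono : ∃ v : HeightOneSpectrum (𝓞 ℚ),
      padicValNat p W.tamagawaProduct ≤ padicValNat p (W.tamagawaNumberAt v) :=
    ⟨v₀, (CornerLocal.padicValNat_tamagawaNumberAt_eq_of_unique_split W p hp5 hs₀ huniq).ge⟩
  exact missingUpperBoundAt_of_classX11b_of_surj_of_monoCarrier_of_jetchevMaxHL_of_hlTwinLowerSupply hGZ hKo hGZK
    hmod hnf hMaz hrec hD36 hMcU p hp2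
    (fun V _ _ _ K _ _ Dt β ι ↦ hJmax V p K Dt β ι hp5) W hX hρ hmono (hsup W p hX hp5 hρ hnram htam honly)

/-- **S1b MODULO THREE PRINTED FACTS, the Cassels–Tate level inputs and the SUPPLY** — the tree's `res_pOnlyMultCarrierAtFive_of_swapPrintFacts_of_lowerX11aFive`
re-keyed (proof verbatim: -w2's swap end `jetchevMaxHLAtP_of_swapPrintFacts`, McCallum Cor. 5.6 upper via Cassels–Tate, the Literature THEOREMS
`heegnerPointOfConductor_one_galoisConj_holds` ∕ `phi_heegnerTau_mem_singularModuliField_holds`). CONDITIONAL; no pair booked.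
[cite: Jetchev2008, Thm. 1.4, Cor. 1.5] [cite: McCallumLMS1991, Cor. 5.6] [cite: GrossLMS1991, §4 (4.1)] [cite: Miller2011LMS, Def. 1.1] -/
theorem res_pOnlyMultCarrierAtFive_of_swapPrintFacts_of_hlTwinLowerSupply
    (hGZ : ∀ (N : ℕ) [NeZero N] (W : WeierstrassCurve ℚ) (K : Type) [Field K] [NumberField K], gross_zagier N W K)
    (hKo : ∀ (N : ℕ) [NeZero N] (W : WeierstrassCurve ℚ) (K : Type) [Field K] [NumberField K], kolyvagin N W K)
    (hGZK : rank_eq_analyticRank_of_analyticRank_le_one) (hmod : hasEntireLFunction_rat)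
    (hnf : exists_isNewformOf) (hMaz : mazur_not_dvd_maninConstant_of_odd)
    (hCTi : ∀ (K : Type) [Field K] [NumberField K], casselsTate_levelInputs K)
    (hF : Literature.NumberTheory.EllipticCurves.GrossLMS1991.prop37_2_frobeniusCongruence ∧
      (∀ (K : Type) [Field K] [NumberField K] (n : ℕ) [NeZero n],
        (Literature.NumberTheory.GaloisCohomology.LocalInvariants.canonical K n).SelmerComplement) ∧
      Literature.NumberTheory.EllipticCurves.Gross1991_heegnerPoint_sub_ratTorsion_mem_E0)
    (hsup : HLTwinLowerSupplyFive) :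
    ∀ (W : WeierstrassCurve ℚ) [W.IsElliptic] [W.IsGloballyMinimal] (p : ℕ) [Fact p.Prime],
      Summit.BirchSwinnertonDyer.Rank1Residual.ClassX11b W p → 5 ≤ p →
      Literature.NumberTheory.EllipticCurves.Rank1Residual.Surj W p →
      ¬ Literature.NumberTheory.EllipticCurves.Rank1Residual.Ram W p → p ∣ W.tamagawaProduct →
      (∀ (ℓ : ℕ) [Fact ℓ.Prime], W.HasMultiplicativeReductionAtPrime ℓ → ℓ = p) →
      W.HasSplitMultiplicativeReductionAtPrime p → p ∣ padicValInt p W.minimalDiscriminantInt →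
      Literature.NumberTheory.EllipticCurves.Rank1Residual.Typed.MissingUpperBoundAt W p :=
  res_pOnlyMultCarrierAtFive_of_jetchevMaxHL_of_hlTwinLowerSupply hGZ hKo hGZK hmod hnf hMaz
    (fun N _ W K _ _ ↦ heegnerPointOfConductor_one_galoisConj_holds N W K)
    (fun N _ W K _ _ ↦ phi_heegnerTau_mem_singularModuliField_holds N W K)
    (McCallum1991_padicValNat_card_sha_primary_add_le_of_globalDivisibility_of_casselsTate_of_frobeniusCongruence_of_E0
      hCTi hF.1 hF.2.2)
    (jetchevMaxHLAtP_of_swapPrintFacts hF hGZ hmod) hsup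

/-- **S1b BY NAME from the route items `PublishedInputsFive`, `ShimuraCasselsTateLevelInputs`, the TWO printed facts and the SUPPLY** — the tree's
`res_pOnlyMultCarrierAtFive_of_items_of_twoPrintFacts_of_lowerX11aFive` re-keyed (proof verbatim; the `SelmerComplement` of THE canonical invariant maps is
the kernel theorem `selmerComplement_canonical_holds`). CONDITIONAL on the displayed inputs; no pair is booked.
[cite: Jetchev2008, Thm. 1.4, Cor. 1.5] [cite: McCallumLMS1991, Cor. 5.6] [cite: GrossLMS1991, Prop. 3.7 (2), §6 Prop. 6.2 (1)] [cite: MilneADT2006, Ch. I Thm. 4.10(b)] -/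
theorem res_pOnlyMultCarrierAtFive_of_items_of_twoPrintFacts_of_hlTwinLowerSupply
    (h₅ : PublishedInputsFive) (hCTi : ShimuraCasselsTateLevelInputs)
    (hF₁ : GrossLMS1991.prop37_2_frobeniusCongruence)
    (hF₃ : Gross1991_heegnerPoint_sub_ratTorsion_mem_E0)
    (hsup : HLTwinLowerSupplyFive) :
    ∀ (W : WeierstrassCurve ℚ) [W.IsElliptic] [W.IsGloballyMinimal] (p : ℕ) [Fact p.Prime],
      ClassX11b W p → 5 ≤ p → Surj W p → ¬ Ram W p → p ∣ W.tamagawaProduct →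
      (∀ (ℓ : ℕ) [Fact ℓ.Prime], W.HasMultiplicativeReductionAtPrime ℓ → ℓ = p) →
      W.HasSplitMultiplicativeReductionAtPrime p → p ∣ padicValInt p W.minimalDiscriminantInt →
      Typed.MissingUpperBoundAt W p := by
  obtain ⟨hGZ, hKo, -, -, -, hGZK, hmod, hnf, -, -, hMaz, -, -, -, -⟩ := h₅
  exact res_pOnlyMultCarrierAtFive_of_swapPrintFacts_of_hlTwinLowerSupply hGZ hKo hGZK hmod hnf hMaz hCTi
    ⟨hF₁, fun K _ _ n _ ↦ SchneiderFreeAdditiveX3.PoitouTateReduction.selmerComplement_canonical_holds K n, hF₃⟩ hsup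

end Summit.BirchSwinnertonDyer.BirchSwinnertonDyer.Cruxes.EulerHalfNotRamNoInertSetAtFive.TwinLowerSupply

/-! ### §2 The `p`-anchor (a multiplicative prime `ℓ ≠ p` exists) RE-KEYED on `Theorems.FHTwinLowerSupplyAt` (corner cores by name) -/

namespace Summit.BirchSwinnertonDyer.BirchSwinnertonDyer.Cruxes.EulerHalfNotRamNoInertSetAtFive.TwinLowerSupply

open WeierstrassCurve Literature.NumberTheory.EllipticCurves Literature.NumberTheory.EllipticCurves.BarriosEtAl2025
  Literature.NumberTheory.EllipticCurves.ModularForms Literature.NumberTheory.EllipticCurves.Rank1Residual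
  Literature.NumberTheory.EllipticCurves.Rank1Residual.Typed Literature.NumberTheory.Automorphic
  Summit.BirchSwinnertonDyer.Rank1Residual Summit.BirchSwinnertonDyer.Rank1Residual.X11b

open NumberField IsDedekindDomain Rat.HeightOneSpectrum CongruenceSubgroup
  Literature.NumberTheory.EllipticCurves.Wuthrich2014
  Literature.NumberTheory.EllipticCurves.BalakrishnanEtAl2019
  Literature.NumberTheory.QuadraticFields.Quadratic
  Summit.BirchSwinnertonDyer.BirchSwinnertonDyer.Theorems
  Summit.BirchSwinnertonDyer.BirchSwinnertonDyer.Theorems.EulerHalfPAnchor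

/-- **S2 via the `p`-anchor RE-KEYED on the twin-lower supply at the pair** — the tree's `eulerHalfNotRam_otherMult_of_pAnchor_of_lowerX11aFive`
(`…OfLowerX11aFive` §2) with the X11a binder REPLACED by `hTL : Theorems.FHTwinLowerSupplyAt W p`: roads (A) (`|O|` odd ⟹ `S = {p} ∪ O`; `O = ∅` ⟹
`S = {p, ℓ}`) now run through corner-p1 g17's datum-free core `missingUpperBoundAt_of_classX11b_of_inertSet_pAnchor_of_twinLowerD` (X11b, `p` odd, ANY
irreducible image; its pair-level display binder is the printed inert fact `hHKi` specialised at `(W, p, p ≥ 5, surj)`; its Tamagawa-shape binder holds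
at `p ≥ 5` by `hasSplitMultiplicativeReduction_of_five_le_of_dvd_localTamagawaNumber`), and the extra-place road (`|O|` even `≥ 2`, display SAVED at
`q₁`) is verbatim, its `hTL` now the hypothesis instead of `fhTwinLowerSupplyAt_of_friedbergHoffstein_of_x11aLowerHalf`. Friedberg–Hoffstein is no
longer used. CONDITIONAL on `hSav`, `hHKi`, `hTL` and the binders; BSD is not proved; item 19715 is NOT closed by this file.
[cite: PastenShimura2024, Prop. 6.13, Lemma 6.15, Lemma 6.18, §6.6] [cite: Jetchev2008, Thm. 1.1, Cor. 1.5] [cite: RibetTakahashi1997, Thm. 1–2] -/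
theorem eulerHalfNotRam_otherMult_of_pAnchor_of_fhTwinLowerSupply
    (h₅ : Summit.BirchSwinnertonDyer.BirchSwinnertonDyer.Theses.ErratumRoadFive.PublishedInputsFive)
    (hJL : Summit.BirchSwinnertonDyer.BirchSwinnertonDyer.Theses.ErratumRoadFive.ShimuraParametrizationDataNonempty)
    (hCO : Summit.BirchSwinnertonDyer.BirchSwinnertonDyer.Theses.ErratumRoadFive.PastenComponentOrdersInput)
    (hHKi : shimuraCurve_heegnerPoint_grossZagier_kolyvagin_inert)
    (hSav : ∀ (W : WeierstrassCurve ℚ) [W.IsElliptic] [W.IsGloballyMinimal] (p : ℕ) [Fact p.Prime]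
      (q₁ : ℕ) [Fact q₁.Prime], ClassX11b W p → 5 ≤ p → Surj W p → ¬ Ram W p →
      W.HasSplitMultiplicativeReductionAtPrime q₁ → p ∣ padicValInt q₁ W.minimalDiscriminantInt →
      Theorems.ShimuraInertSavedDisplayAtD W p q₁)
    (W : WeierstrassCurve ℚ) [W.IsElliptic] [W.IsGloballyMinimal] (p : ℕ) [Fact p.Prime]
    (hX : ClassX11b W p) (hp5 : 5 ≤ p) (hsurj : Surj W p) (hnram : ¬ Ram W p)
    (hother : ∃ (ℓ : ℕ) (_ : Fact ℓ.Prime), ℓ ≠ p ∧ W.HasMultiplicativeReductionAtPrime ℓ)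
    (hTL : Theorems.FHTwinLowerSupplyAt W p) :
    Typed.MissingUpperBoundAt W p := by
  classical
  obtain ⟨-, -, -, -, -, hGZK, hmod, hnf, -, -, hMaz, -, -, -, -⟩ := h₅
  obtain ⟨hr, hp2, hmult, hirr⟩ := id hX
  have hN0 : W.conductorNorm ℤ ≠ 0 := (W.conductorNorm_pos_holds).ne'
  -- the TAMAGAWA SHAPE at `p ≥ 5`: a prime with `p ∣ c_q` is split multiplicative
  have hshape : ∀ (q : ℕ) [Fact q.Prime], p ∣ (W.baseChange ℚ_[q]).localTamagawaNumber ℤ_[q] →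
      W.HasSplitMultiplicativeReductionAtPrime q := by
    intro q _ hdvd
    haveI : (W.baseChange ℚ_[q]).IsElliptic := inferInstanceAs (W.map (algebraMap ℚ ℚ_[q])).IsElliptic
    exact hasSplitMultiplicativeReduction_of_five_le_of_dvd_localTamagawaNumber q (W.baseChange ℚ_[q]) hp5 hdvd
  -- the offending split `p`-carriers other than `p`
  set O : Finset ℕ := (W.conductorNorm ℤ).primeFactors.filter (fun q ↦ q ≠ p ∧
      ∃ h : q.Prime, @WeierstrassCurve.HasSplitMultiplicativeReductionAtPrime W q ⟨h⟩ ∧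
        p ∣ padicValInt q W.minimalDiscriminantInt) with hOdef
  have hOmult : ∀ q ∈ O, ∃ _ : Fact q.Prime, Mult W q := by
    intro q hq
    obtain ⟨-, -, hqprime, hsplit, -⟩ := Finset.mem_filter.mp hq
    haveI hqF : Fact q.Prime := ⟨hqprime⟩
    exact ⟨hqF, hsplit.hasMultiplicativeReductionAtPrime⟩
  have hpO : p ∉ O := fun h ↦ (Finset.mem_filter.mp h).2.1 rfl
  have hcapture : ∀ (ℓ : ℕ) [Fact ℓ.Prime], ℓ ≠ p → W.HasSplitMultiplicativeReductionAtPrime ℓ →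
      p ∣ padicValInt ℓ W.minimalDiscriminantInt → ℓ ∈ O := by
    intro ℓ hℓ hne hs hc
    have hℓN : ℓ ∣ W.conductorNorm ℤ :=
      (W.dvd_conductorNorm_iff_not_hasGoodReductionAtPrime ℓ).mpr
        (WeierstrassCurve.HasMultiplicativeReduction.not_hasGoodReduction (R := ℤ_[ℓ])
          hs.hasMultiplicativeReductionAtPrime)
    exact Finset.mem_filter.mpr ⟨Nat.mem_primeFactors.mpr ⟨hℓ.out, hℓN, hN0⟩, hne, hℓ.out, hs, hc⟩
  rcases Nat.even_or_odd O.card with hev | hodd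
  swap
  · ------------------------------------------------------------ `|O|` odd: road (A)'s frame `S = {p} ∪ O`, twin-lower core
    refine missingUpperBoundAt_of_classX11b_of_inertSet_pAnchor_of_twinLowerD hGZK hmod hnf hMaz
      localTamagawaNumber_quadraticTwist_two_mem_of_goodReduction_holds hJL hCO W p hX hshape
      (fun N _ K _ _ S Dt X W' _ P₀ hN hK _ ↦ hHKi W p N K S Dt X W' P₀ hN hp5 hsurj hK) hTL
      (insert p O) ?_ ?_ (Finset.mem_insert_self p O) ?_
    · intro ℓ hℓ
      rcases Finset.mem_insert.mp hℓ with rfl | hℓO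
      · exact ⟨inferInstance, hmult⟩
      · exact hOmult ℓ hℓO
    · rw [Finset.card_insert_of_notMem hpO]; exact hodd.add_one
    · intro ℓ _ hℓS hs hc
      by_cases hne : ℓ = p
      · subst hne; exact (hℓS (Finset.mem_insert_self _ _)).elim
      · exact (hℓS (Finset.mem_insert_of_mem (hcapture ℓ hne hs hc))).elim
  by_cases hO0 : O = ∅
  · ------------------------------------------------------------ no offender `≠ p`: road (A)'s frame `S = {p, ℓ}`, twin-lower core
    obtain ⟨ℓ, hℓF, hℓp, hℓm⟩ := hother
    refine missingUpperBoundAt_of_classX11b_of_inertSet_pAnchor_of_twinLowerD hGZK hmod hnf hMaz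
      localTamagawaNumber_quadraticTwist_two_mem_of_goodReduction_holds hJL hCO W p hX hshape
      (fun N _ K _ _ S Dt X W' _ P₀ hN hK _ ↦ hHKi W p N K S Dt X W' P₀ hN hp5 hsurj hK) hTL
      (insert p {ℓ}) ?_ ?_ (Finset.mem_insert_self p _) ?_
    · intro q hq
      rcases Finset.mem_insert.mp hq with rfl | hq'
      · exact ⟨inferInstance, hmult⟩
      · rw [Finset.mem_singleton] at hq'
        subst hq'
        exact ⟨hℓF, hℓm⟩
    · rw [Finset.card_pair (Ne.symm hℓp)]; exact even_two
    · intro q _ hqS hs hc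
      by_cases hne : q = p
      · subst hne; exact (hqS (Finset.mem_insert_self _ _)).elim
      · have hqO := hcapture q hne hs hc
        rw [hO0] at hqO
        exact (Finset.notMem_empty q hqO).elim
  · ------------------------------------------------------------ `|O|` even `≥ 2`: exempt `q₁ ∈ O`, the extra-place frame
    obtain ⟨q₁, hq₁O⟩ := Finset.nonempty_iff_ne_empty.mpr hO0
    obtain ⟨-, hq₁p, hq₁prime, hsplit₁, hcar₁⟩ := Finset.mem_filter.mp hq₁O
    haveI hq₁F : Fact q₁.Prime := ⟨hq₁prime⟩
    have hbad₁ : ¬ W.HasGoodReductionAtPrime q₁ :=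
      WeierstrassCurve.HasMultiplicativeReduction.not_hasGoodReduction (R := ℤ_[q₁])
        hsplit₁.hasMultiplicativeReductionAtPrime
    have hshape₁ : ∀ (q : ℕ) [Fact q.Prime], q ≠ q₁ → p ∣ (W.baseChange ℚ_[q]).localTamagawaNumber ℤ_[q] →
        W.HasSplitMultiplicativeReductionAtPrime q := fun q _ _ hdvd ↦ hshape q hdvd
    have hSavD : Theorems.ShimuraInertSavedDisplayAtD W p q₁ := hSav W p q₁ hX hp5 hsurj hnram hsplit₁ hcar₁
    have hpO' : p ∉ O.erase q₁ := fun h ↦ hpO (Finset.mem_of_mem_erase h)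
    refine missingUpperBoundAt_of_classX11b_of_inertSet_of_extraPlace_odd_of_twinLowerD_pAnchor hGZK hmod hnf hMaz
      localTamagawaNumber_quadraticTwist_two_mem_of_goodReduction_holds hJL hCO W p hX hp5 hsurj q₁ hbad₁ hshape₁ hSavD hTL
      (insert p (O.erase q₁)) ?_ ?_ (Finset.mem_insert_self p _) ?_ ?_
    · intro ℓ hℓ
      rcases Finset.mem_insert.mp hℓ with rfl | hℓO
      · exact ⟨inferInstance, hmult⟩
      · exact hOmult ℓ (Finset.mem_of_mem_erase hℓO)
    · rw [Finset.card_insert_of_notMem hpO', Finset.card_erase_of_mem hq₁O,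
        Nat.sub_add_cancel (Finset.card_pos.mpr ⟨q₁, hq₁O⟩)]
      exact hev
    · intro h
      rcases Finset.mem_insert.mp h with h | h
      · exact hq₁p h
      · exact Finset.notMem_erase q₁ O h
    · intro ℓ _ hℓS hne hs hc
      by_cases hℓp : ℓ = p
      · subst hℓp; exact (hℓS (Finset.mem_insert_self _ _)).elim
      · exact (hℓS (Finset.mem_insert_of_mem (Finset.mem_erase.mpr ⟨hne, hcapture ℓ hℓp hs hc⟩))).elim

end Summit.BirchSwinnertonDyer.BirchSwinnertonDyer.Cruxes.EulerHalfNotRamNoInertSetAtFive.TwinLowerSupply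

/-! ### §3 The branching composition (S1b ∣ `p`-anchor) on the two SUPPLIES; the crux BY NAME from six items + two supplies -/

namespace Summit.BirchSwinnertonDyer.BirchSwinnertonDyer.Cruxes.EulerHalfNotRamNoInertSetAtFive.TwinLowerSupply

open Summit.BirchSwinnertonDyer.BirchSwinnertonDyer.Theses.ErratumRoadFive
open Literature.NumberTheory.EllipticCurves Literature.NumberTheory.EllipticCurves.Rank1Residual
  Literature.NumberTheory.EllipticCurves.Rank1Residual.Typed
open Summit.BirchSwinnertonDyer.Rank1Residual Summit.BirchSwinnertonDyer.BirchSwinnertonDyer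
  Summit.BirchSwinnertonDyer.BirchSwinnertonDyer.Theorems

/-- **CRUX 19715 BY NAME FROM FIVE ROUTE ITEMS + THE TWO SUPPLIES + THE TWO PRINTED FACTS + SAV.** The tree's
`eulerHalfNotRamNoInertSetAtFive_of_items_of_twoPrintFacts_of_SAV_of_lowerX11aFive` with the X11a binder replaced by the two supply statements
(proof verbatim over §1 ∕ §2: `p` the only multiplicative prime ⟹ S1b on `HLTwinLowerSupplyFive`; otherwise the `p`-anchor on `FHTwinLowerSupplyFive`, `hSav`
and the inert display from the items). CONDITIONAL; 19715 NOT closed by this file.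
[cite: Jetchev2008, Thm. 1.4, Cor. 1.5] [cite: PastenShimura2024, Prop. 6.13, Lemma 6.18, §6.6] [cite: SilvermanATAEC1994, Cor. IV.9.2 (d)] -/
theorem eulerHalfNotRamNoInertSetAtFive_of_items_of_twoPrintFacts_of_SAV_of_supplies
    (h₅ : PublishedInputsFive) (hHL5 : HLTwinLowerSupplyFive) (hFH5 : FHTwinLowerSupplyFive)
    (hJL : ShimuraParametrizationDataNonempty)
    (hCO : PastenComponentOrdersInput) (hCTi : ShimuraCasselsTateLevelInputs)
    (hESi : ShimuraHeegnerEulerSystemInertPrintedR)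
    (hF₁ : GrossLMS1991.prop37_2_frobeniusCongruence)
    (hF₃ : Gross1991_heegnerPoint_sub_ratTorsion_mem_E0)
    (hSav : ∀ (W : WeierstrassCurve ℚ) [W.IsElliptic] [W.IsGloballyMinimal] (p : ℕ) [Fact p.Prime]
      (q₁ : ℕ) [Fact q₁.Prime], ClassX11b W p → 5 ≤ p → Surj W p → ¬ Ram W p →
      W.HasSplitMultiplicativeReductionAtPrime q₁ → p ∣ padicValInt q₁ W.minimalDiscriminantInt →
      Theorems.ShimuraInertSavedDisplayAtD W p q₁) :
    EulerHalfNotRamNoInertSetAtFive := by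
  intro W _ _ p _ hX hp5 hsurj hram htam _hno
  by_cases h : ∀ (ℓ : ℕ) [Fact ℓ.Prime], W.HasMultiplicativeReductionAtPrime ℓ → ℓ = p
  · -- `p` is the only multiplicative prime: the split carrier that `p ∣ ∏c` provides is multiplicative, hence it is `p`
    obtain ⟨ℓ, hℓ, hsplit, hdvd⟩ := (X11b.dvd_tamagawaProduct_iff_exists_split (W := W) (Fact.out : p.Prime) hp5).mp htam
    have hℓp : ℓ = p := h ℓ hsplit.hasMultiplicativeReductionAtPrime
    subst hℓp
    exact res_pOnlyMultCarrierAtFive_of_items_of_twoPrintFacts_of_hlTwinLowerSupply h₅ hCTi hF₁ hF₃ hHL5 W _ hX hp5 hsurj hram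
      htam h hsplit hdvd
  · have hother : ∃ (ℓ : ℕ) (_ : Fact ℓ.Prime), ℓ ≠ p ∧ W.HasMultiplicativeReductionAtPrime ℓ := by
      by_contra hc
      exact h fun ℓ _ hm ↦ by_contra fun hne ↦ hc ⟨ℓ, ‹_›, hne, hm⟩
    exact eulerHalfNotRam_otherMult_of_pAnchor_of_fhTwinLowerSupply h₅ hJL hCO
      (Theorems.EulerHalfPAnchor.shimuraInertDisplayKolyvagin_of_items h₅ hCTi hESi) hSav W p hX hp5 hsurj hram hother
      (hFH5 W p hX hp5 hsurj hram hother)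

/-- **CRUX 19715 `EulerHalfNotRamNoInertSetAtFive` BY NAME FROM SIX ROUTE ITEMS + THE TWO SUPPLIES — ROAD A** (SAV supplier
`EulerHalfAuxNorm.shimuraInertSavedDisplayAtFive_of_items_of_threeLeaves` over the width seats' tree theorems S1-lin ∕ (C) ∕ (O), as p651418 ∕ p657101).
`PublishedInputsFive` (19066), `ShimuraParametrizationDataNonempty` (19524), `PastenComponentOrdersInput` (19716), `ShimuraCasselsTateLevelInputs` (20191),
`ShimuraHeegnerEulerSystemInertPrintedR` (20442), `EulerHalfGrossPrintFacts` (27981), `HLTwinLowerSupplyFive`, `FHTwinLowerSupplyFive`. Crux 19064 is NOT an input.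
CONDITIONAL on the displayed inputs; item 19715 stays ledger-`open`; BSD is proved for no curve.
[cite: GrossLMS1991, §6 p. 245] [cite: Jetchev2008, Thm. 1.4, Cor. 1.5] [cite: PastenShimura2024, Lemma 6.18, Prop. 6.13] [cite: Cox2013, Thm. 8.12, §9.A] -/
theorem eulerHalfNotRamNoInertSetAtFive_of_sixItems_of_supplies
    (h₅ : PublishedInputsFive) (hJL : ShimuraParametrizationDataNonempty)
    (hCO : PastenComponentOrdersInput) (hCTi : ShimuraCasselsTateLevelInputs)
    (hESi : ShimuraHeegnerEulerSystemInertPrintedR) (hF2 : EulerHalfGrossPrintFacts)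
    (hHL5 : HLTwinLowerSupplyFive) (hFH5 : FHTwinLowerSupplyFive) :
    EulerHalfNotRamNoInertSetAtFive :=
  eulerHalfNotRamNoInertSetAtFive_of_items_of_twoPrintFacts_of_SAV_of_supplies h₅ hHL5 hFH5 hJL hCO hCTi hESi hF2.1
    (Gross1991_heegnerPoint_sub_ratTorsion_mem_E0_of_imageFree hF2.2)
    (EulerHalfAuxNorm.shimuraInertSavedDisplayAtFive_of_items_of_threeLeaves h₅ hCTi hESi
      (fun W _ _ K _ _ ι _ hK q _ hs hq2 ↦ TateComponent.stub_tateComponentFamilyLinear W K ι hK q hs hq2)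
      (fun W _ _ K _ _ hK hdK p _ hp5 hsurj ↦ stub_chebotarevKummerSupply W K hK hdK p hp5 hsurj)
      (fun K _ _ hK hdK p _ hp3 q _ hq2 ↦ stub_splitPrimeKummerWitness K hK hdK p hp3 q hq2))

/-- **The same, ROAD B** (SAV supplier `EulerHalfGalTrivialRoad.shimuraInertSavedDisplayAtFive_of_items`, p650861). CONDITIONAL on the displayed inputs;
item 19715 stays ledger-`open`; BSD is proved for no curve. [cite: GrossLMS1991, §6 p. 245] [cite: Jetchev2008, Thm. 1.4, Cor. 1.5] [cite: PastenShimura2024, Lemma 6.18] -/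
theorem eulerHalfNotRamNoInertSetAtFive_of_sixItems_of_supplies_roadB
    (h₅ : PublishedInputsFive) (hJL : ShimuraParametrizationDataNonempty)
    (hCO : PastenComponentOrdersInput) (hCTi : ShimuraCasselsTateLevelInputs)
    (hESi : ShimuraHeegnerEulerSystemInertPrintedR) (hF2 : EulerHalfGrossPrintFacts)
    (hHL5 : HLTwinLowerSupplyFive) (hFH5 : FHTwinLowerSupplyFive) :
    EulerHalfNotRamNoInertSetAtFive :=
  eulerHalfNotRamNoInertSetAtFive_of_items_of_twoPrintFacts_of_SAV_of_supplies h₅ hHL5 hFH5 hJL hCO hCTi hESi hF2.1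
    (Gross1991_heegnerPoint_sub_ratTorsion_mem_E0_of_imageFree hF2.2)
    (EulerHalfGalTrivialRoad.shimuraInertSavedDisplayAtFive_of_items h₅ hCTi hESi)

/-! ### §4 MONOTONICITY: both supplies ⟸ `PublishedInputsFive` ∧ the `p ≥ 5` X11a lower half (the line of record factors through this line) -/

/-- **Both supply statements follow from `PublishedInputsFive` (Hoffstein–Luo, Friedberg–Hoffstein, modularity, GZK) and the `p ≥ 5` restriction of
crux 19064** — so this line's two stubs are each WEAKER than the input they replace, and re-keying costs nothing. Bookkeeping over §0 and the tree's
`fhTwinLowerSupplyAt_of_friedbergHoffstein_of_x11aLowerHalf`. [cite: HoffsteinLuo1997, Theorem (§1)] [cite: FriedbergHoffstein1995, Thm. B] [cite: Miller2011LMS, Def. 1.1] -/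
theorem supplies_of_publishedInputsFive_of_lowerX11aFive (h₅ : PublishedInputsFive)
    (h₃ : ∀ (Wd : WeierstrassCurve ℚ) [Wd.IsElliptic] [Wd.IsGloballyMinimal] (p : ℕ) [Fact p.Prime],
      ClassX11a Wd p → 5 ≤ p → Typed.MissingLowerBoundAt Wd p) :
    HLTwinLowerSupplyFive ∧ FHTwinLowerSupplyFive := by
  obtain ⟨-, -, -, -, -, hGZK, hmod, hnf, hHL, -, -, -, hFH, -, -⟩ := h₅
  refine ⟨fun W _ _ p _ hX hp5 _ hnram _ _ ↦
      hlTwinLowerSupplyAt_of_hoffsteinLuo_of_lowerX11aFive hmod hnf hHL h₃ W p hX hp5 hnram,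
    fun W _ _ p _ hX hp5 _ hnram _ ↦ ?_⟩
  exact fhTwinLowerSupplyAt_of_friedbergHoffstein_of_x11aLowerHalf hGZK hmod hnf hFH W p hX hnram
    (fun Wd _ _ hXa ↦ h₃ Wd p hXa hp5)

/-- **Sanity: the LEAD's theorem of record (p657101, road A) re-derived THROUGH the supplies** — crux 19715 BY NAME ⟸ six items + the `p ≥ 5` X11a lower
half, as `…_of_sixItems_of_supplies ∘ supplies_of_publishedInputsFive_of_lowerX11aFive`. Shows the recut factors the line of record (nothing is lost).
Bookkeeping. [cite: Jetchev2008, Thm. 1.4, Cor. 1.5] [cite: PastenShimura2024, Lemma 6.18] -/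
theorem eulerHalfNotRamNoInertSetAtFive_of_sixItems_of_lowerX11aFive'
    (h₅ : PublishedInputsFive) (hJL : ShimuraParametrizationDataNonempty)
    (hCO : PastenComponentOrdersInput) (hCTi : ShimuraCasselsTateLevelInputs)
    (hESi : ShimuraHeegnerEulerSystemInertPrintedR) (hF2 : EulerHalfGrossPrintFacts)
    (h₃ : ∀ (Wd : WeierstrassCurve ℚ) [Wd.IsElliptic] [Wd.IsGloballyMinimal] (p : ℕ) [Fact p.Prime],
      ClassX11a Wd p → 5 ≤ p → Typed.MissingLowerBoundAt Wd p) :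
    EulerHalfNotRamNoInertSetAtFive :=
  eulerHalfNotRamNoInertSetAtFive_of_sixItems_of_supplies h₅ hJL hCO hCTi hESi hF2
    (supplies_of_publishedInputsFive_of_lowerX11aFive h₅ h₃).1 (supplies_of_publishedInputsFive_of_lowerX11aFive h₅ h₃).2

/-! ### §5 The line's composition: the crux BY NAME from the two stubs' statements + the six route items -/

/-- **LINE COMPOSITION (kernel-checked, sorry-free): crux 19715 `EulerHalfNotRamNoInertSetAtFive` ⟸ `HLTwinLowerSupplyFive` → `FHTwinLowerSupplyFive` → the
six route items** (road A; road B is `…_of_sixItems_of_supplies_roadB`). The antecedents are exactly the statements of `stub_hlTwinLowerSupplyFive`,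
`stub_fhTwinLowerSupplyFive` and the items 19066, 19524, 19716, 20191, 20442, 27981. Nothing about any curve is asserted; 19715 stays `open`.
[cite: Jetchev2008, Thm. 1.4, Cor. 1.5] [cite: PastenShimura2024, Lemma 6.18, Prop. 6.13] [cite: OnoSkinner1998, Cor. 2 (arXiv numbering; shape of the stubs)] -/
theorem EulerHalfNotRamNoInertSetAtFive_of :
    HLTwinLowerSupplyFive → FHTwinLowerSupplyFive → PublishedInputsFive → ShimuraParametrizationDataNonempty →
      PastenComponentOrdersInput → ShimuraCasselsTateLevelInputs → ShimuraHeegnerEulerSystemInertPrintedR → EulerHalfGrossPrintFacts →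
      Summit.BirchSwinnertonDyer.BirchSwinnertonDyer.Theses.ErratumRoadFive.EulerHalfNotRamNoInertSetAtFive :=
  fun hHL5 hFH5 h₅ hJL hCO hCTi hESi hF2 ↦
    eulerHalfNotRamNoInertSetAtFive_of_sixItems_of_supplies h₅ hJL hCO hCTi hESi hF2 hHL5 hFH5

/-- The crux modulo the six items, from the two STUBS (the form a LEAD would register; here only elaborated). -/
theorem eulerHalfNotRamNoInertSetAtFive_of_sixItems_of_stubs
    (h₅ : PublishedInputsFive) (hJL : ShimuraParametrizationDataNonempty)
    (hCO : PastenComponentOrdersInput) (hCTi : ShimuraCasselsTateLevelInputs)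
    (hESi : ShimuraHeegnerEulerSystemInertPrintedR) (hF2 : EulerHalfGrossPrintFacts) :
    EulerHalfNotRamNoInertSetAtFive :=
  EulerHalfNotRamNoInertSetAtFive_of stub_hlTwinLowerSupplyFive stub_fhTwinLowerSupplyFive h₅ hJL hCO hCTi hESi hF2


end Summit.BirchSwinnertonDyer.BirchSwinnertonDyer.Cruxes.EulerHalfNotRamNoInertSetAtFive.TwinLowerSupply

end
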